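import Mathlib
import HarnessLib
import Literature.Computability.AlgebraicComplexity.OrbitClosure
import Literature.Computability.AlgebraicComplexity.DeterminantalConormalBound
import Summits.ValiantsHypothesis.ValiantsHypothesis.Theses.BorderApolarity

/-!
# Sketch — crux-ideate cards for `BorderDcPerThreeSix` (stmt-ValiantsHypothesis-5780)

First-lemma signatures of the idea cards (they need not be proved here; they must elaborate).
Crux: `paddedPerPoly ℂ 3 5 ∉ orbitClosure (detPoly (Fin 5) ℂ)` (bdc(per₃) ≥ 6).
-/

namespace Summit.ValiantsHypothesis.ValiantsHypothesis.Cruxes.BorderDcPerThreeSix.Sketch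

open MvPolynomial Literature.Computability.AlgebraicComplexity
open Summit.ValiantsHypothesis.ValiantsHypothesis.Theses.BorderApolarity (BorderDcPerThreeSix)

/-! ## Card A — class of the permanental cubic vs. Sheshadri's size-5 Bézout number -/

/-- Card A, FIRST LEMMA: for generic pencil/chart data `u = (a, b, c)` the polar (tangency) set of
the permanental cubic sevenfold `Z(per₃) ⊂ ℙ⁸` has MORE than `B(5, 9) = conormalBezout 5 9 = 315`
points, i.e. the class `deg Z(per₃)^∨` (a hypersurface by Landsberg–Manivel–Ressayre) exceeds 315.
(Numerics pending/attached on the card; smooth cubics have class 384.) -/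
def ClassPerThreeExceedsBezout : Prop :=
  ∃ Φ : MvPolynomial (Fin 3 × (Fin 3 × Fin 3)) ℂ, Φ ≠ 0 ∧
    ∀ u : Fin 3 × (Fin 3 × Fin 3) → ℂ, eval u Φ ≠ 0 →
      conormalBezout 5 9 <
        (polarSet (perPoly (Fin 3) ℂ) (fun i => u (0, i)) (fun i => u (1, i)) (fun i => u (2, i))).ncard

/-- Card A, the transfer fact the line leans on: Sheshadri's conormal-specialization chain
(arXiv:2606.13628 Thm 3 (i) + Lemmas 7–17 / Prop. 8, Cor. 8) run with the padded permanent
`X₀₀^{m-n} per_n` as special fibre instead of the Fermat cone (the paper's §10 item 7: "the transfer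
machinery would apply once such a bound exists"): border determinantal complexity `≤ m` bounds the
generic polar count of `Z(per_n) ⊂ ℙ^{n²-1}` by `B(m, n²)`. -/
def BorderPolarCountLe : Prop :=
  ∀ (n m : ℕ) [NeZero m], 2 ≤ n → n ≤ m →
    paddedPerPoly ℂ n m ∈ orbitClosure (detPoly (Fin m) ℂ) →
      ∃ Φ : MvPolynomial (Fin 3 × (Fin n × Fin n)) ℂ, Φ ≠ 0 ∧
        ∀ u : Fin 3 × (Fin n × Fin n) → ℂ, eval u Φ ≠ 0 →
          (polarSet (perPoly (Fin n) ℂ) (fun i => u (0, i)) (fun i => u (1, i))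
              (fun i => u (2, i))).ncard ≤ conormalBezout m (n * n)

/-- How Card A closes the crux (pure logic: two generic conditions have a common witness over `ℂ`). -/
theorem borderDcPerThreeSix_of_class (hT : BorderPolarCountLe) (hC : ClassPerThreeExceedsBezout) :
    BorderDcPerThreeSix := by
  intro hmem
  obtain ⟨Φ₁, hΦ₁, h₁⟩ := hT 3 5 (by norm_num) (by norm_num) hmem
  obtain ⟨Φ₂, hΦ₂, h₂⟩ := hC
  have hne : Φ₁ * Φ₂ ≠ 0 := mul_ne_zero hΦ₁ hΦ₂
  obtain ⟨u, hu⟩ : ∃ u, eval u (Φ₁ * Φ₂) ≠ 0 := by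
    by_contra hall
    push_neg at hall
    exact hne (MvPolynomial.funext fun u => by simpa using hall u)
  rw [map_mul] at hu
  have k₁ := h₁ u (left_ne_zero_of_mul hu)
  have k₂ := h₂ u (right_ne_zero_of_mul hu)
  have h9 : conormalBezout 5 (3 * 3) = conormalBezout 5 9 := by norm_num
  rw [h9] at k₁
  exact absurd (lt_of_lt_of_le k₂ k₁) (lt_irrefl _)

/-! ## Card B — valuative normal form: no FIRST-ORDER boundary representation -/

/-- Card B, FIRST LEMMA: the padded permanent is not a first-order boundary point of `Δ(det₅)`:
there are no `5 × 5` matrices `M₀, M₁` of linear forms (in the 25 variables) with `det M₀ ≡ 0` and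
`[t¹] det(M₀ + t M₁) = Σ_j det(M₀ with column j replaced by that of M₁) = X₀₀² per₃`. -/
def NoFirstOrderBoundaryRep : Prop :=
  ¬ ∃ (M₀ M₁ : Matrix (Fin 5) (Fin 5) (MvPolynomial (Fin 5 × Fin 5) ℂ)),
      (∀ i j, (M₀ i j).IsHomogeneous 1) ∧ (∀ i j, (M₁ i j).IsHomogeneous 1) ∧
      M₀.det = 0 ∧ ∑ j, (M₀.updateCol j fun i => M₁ i j).det = paddedPerPoly ℂ 3 5

/-! ## Card C — the torus (degree) trick: degree-≤3 affine determinants -/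

/-- Card C, FIRST LEMMA (its NEGATION refutes the crux): there is no `5 × 5` matrix `A` of affine
linear forms in the nine variables with `deg (det A) ≤ 3` and cubic part `(det A)₃ = per₃`
(for then `per₃ = lim_{s→∞} s⁻³ det A(s x)` is a limit of size-5 affine determinants). -/
def NoDegreeThreeAffineDetTop : Prop :=
  ¬ ∃ A : Matrix (Fin 5) (Fin 5) (MvPolynomial (Fin 3 × Fin 3) ℂ),
      (∀ i j, (A i j).totalDegree ≤ 1) ∧ A.det.totalDegree ≤ 3 ∧
      homogeneousComponent 3 A.det = perPoly (Fin 3) ℂ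


/-! ## Card C — sectional transfer to SIX variables: padded cubic threefolds vs 5×5 determinants -/

/-- The small model: quintic forms in six variables that are Zariski limits of determinants of
`5 × 5` matrices of linear forms in those six variables (`Y₆` of the card). -/
def detLimitSix : Set (MvPolynomial (Fin 6) ℂ) :=
  {g | coeffVec g ∈ zariskiClosure (coeffVec ''
    {f | ∃ M : Matrix (Fin 5) (Fin 5) (MvPolynomial (Fin 6) ℂ),
      (∀ i j, (M i j).IsHomogeneous 1) ∧ M.det = f})}

/-- Card C, the transferred target `C⁺`: SOME cubic form `C(s₁,…,s₅)` in five variables has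
`s₀² · C ∉ Y₆` — e.g. the Fermat cubic threefold `Σ sᵢ³`, whose honest dc is `≥ 6` by
Alper–Bogart–Velasco (smooth cone, codim Sing = 5). Any single such `C` will do. -/
def SomePaddedQuinaryCubicEscapes : Prop :=
  ∃ C : MvPolynomial (Fin 5) ℂ, C.IsHomogeneous 3 ∧
    X 0 ^ 2 * rename Fin.succ C ∉ detLimitSix

/-- Card C, FIRST LEMMA (the transfer; pure structure, provable now): restriction of the ten
variables to six (ℓ ↦ s₀, x ↦ x(s₁..s₅) linear) maps `Δ(det₅)` into `Y₆`, the locus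
`{C : s₀²C ∈ Y₆}` is Zariski closed in `S³(ℂ⁵)`, and quinary cubics are dominated by linear sections
`per₃ ∘ x` (the differential of `x ↦ per₃ ∘ x` has rank 35 = dim S³(ℂ⁵) at one rational point),
so one escaping cubic forces `X₀₀² per₃ ∉ Δ(det₅)`. -/
def SectionalTransfer : Prop :=
  SomePaddedQuinaryCubicEscapes → BorderDcPerThreeSix

end Summit.ValiantsHypothesis.ValiantsHypothesis.Cruxes.BorderDcPerThreeSix.Sketch
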